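import Summits.CriticalPhenomena.PercolationContinuityZ3.Theorems.PercNearOneGluingNoHeavyLowerTailOwnDisconnection
import Literature.Probability.Percolation.TwoClusterExchange
import HarnessLib

/-!
# `NoHeavyLowerTail` (stmt-CriticalPhenomena-4575) — GIANT EXCHANGES: the tripod / path / diamond inequalities
# with the sink replaced by "holds ≥ j+1 relays" (cardinality-typed two-group conditional association)

Support file (prover `prim-lf-7`, lemma factory "k-cluster conditional association"; `--supports stmt-CriticalPhenomena-4575`).
No definitions, no named facts, no sorries.

Setting: bond percolation `μ = prodBernoulli w` on a finite vertex type, a finite relay set `A`, a level `j`, vertices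
`o, x, y`; `|π(v)| := #{a ∈ A : v ↔ a}` (`(A.filter fun a => ω ∈ openConn v a).card`), "`v` light" `:= |π(v)| ≤ j`,
"`v` heavy" `:= j + 1 ≤ |π(v)|`.  The honest multi-terminal content of van den Berg–Häggström–Kahn's conditional association is
its two-GROUP form with MONOTONE CARDINALITY FUNCTIONALS: `{|π(x)| ≥ m}` is increasing in the open cluster `C_x`,
`{|π(x)| ≤ m}` decreasing.  Feeding these into the tree's exchange theorems (`Literature.twoClusterExchange`,
`Literature.setClusterEventExchange`) gives the GIANT versions of the four-point sink inequalities of the kcluster line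
(`Literature.tripodExchange`, `Theorems.pathExchange`, `Theorems.diamond`), in which "`v ↔ b`" is replaced by "`v` heavy":

* `giant_tripodExchange`   `μ(o↔x, x light, y heavy)·μ(o↔y, y light, x heavy) ≤ μ(o↔x, x heavy, y light)·μ(o↔y, y heavy, x light)`
  (all `A, j`);
* `giant_pathExchange`     `μ(o↔x, x light, y heavy)·μ(o↮x, o↮y, x heavy, y light) ≤ μ(o↔x, x heavy, y light)·μ(o↮x, o↮y, x light, y heavy)`
  (for `|A| ≤ 2j+1`, i.e. at most one heavy cluster);

The sequel file `…GiantDiamond.lean` combines the two into the giant diamond `μ(o↔x | x light, y heavy) ≤ μ(o↔x | x heavy, y light)`,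
the attached light/heavy transfer at a champion and the singleton Hall cut of the attached-champion inequality (XZ = CST).
-/

noncomputable section

namespace Summit.CriticalPhenomena.PercolationContinuityZ3.Theorems

open MeasureTheory Set Literature.Probability.LatticeModels Literature.Probability.Percolation
open scoped Classical

namespace GiantExchange

variable {V : Type*}

/-- Monotonicity of a filtered cardinality under pointwise implication. [folklore] -/
theorem card_filter_mono (A : Finset V) {P Q : V → Prop} (h : ∀ b ∈ A, P b → Q b) :
    (A.filter P).card ≤ (A.filter Q).card := by
  apply Finset.card_le_card
  intro a ha
  rw [Finset.mem_filter] at ha ⊢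
  exact ⟨ha.1, h a ha.1 ha.2⟩

/-- If `C_x ω ⊆ C_x ω'` then every vertex joined to `x` in `ω` is joined to `x` in `ω'`. [folklore] -/
theorem openConn_of_cluster_subset {x v : V} ⦃ω ω' : BondConfig V⦄
    (hs : openEdgeCluster ω x ⊆ openEdgeCluster ω' x) (h : ω ∈ (openConn x v : Set (BondConfig V))) :
    ω' ∈ (openConn x v : Set (BondConfig V)) := by
  change (openGraph ω').Reachable x v
  rw [reachable_iff_exists_mem_openEdgeCluster]
  rcases (reachable_iff_exists_mem_openEdgeCluster ω x v).1 h with h1 | ⟨e, he, hve⟩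
  · exact Or.inl h1
  · exact Or.inr ⟨e, hs he, hve⟩

/-- `|π(x)|` is monotone in `C_x`. [folklore] -/
theorem card_mono_of_cluster_subset (A : Finset V) {x : V} ⦃ω ω' : BondConfig V⦄
    (hs : openEdgeCluster ω x ⊆ openEdgeCluster ω' x) :
    (A.filter fun a => ω ∈ openConn x a).card ≤ (A.filter fun a => ω' ∈ openConn x a).card :=
  card_filter_mono A fun _ _ ha => openConn_of_cluster_subset hs ha

/-- Joined vertices have the same relay count. [folklore] -/
theorem card_eq_of_reachable (A : Finset V) {x y : V} {ω : BondConfig V} (h : (openGraph ω).Reachable x y) :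
    (A.filter fun a => ω ∈ openConn x a).card = (A.filter fun a => ω ∈ openConn y a).card := by
  congr 1
  ext b
  simp only [Finset.mem_filter, openConn, mem_setOf_eq]
  exact and_congr_right fun _ => ⟨fun hxb => h.symm.trans hxb, fun hyb => h.trans hyb⟩

/-- "`x` light and `y` heavy" forces `x ↮ y`. [folklore] -/
theorem not_reachable_of_light_heavy (A : Finset V) {x y : V} {j : ℕ} {ω : BondConfig V}
    (hx : (A.filter fun a => ω ∈ openConn x a).card ≤ j) (hy : j + 1 ≤ (A.filter fun a => ω ∈ openConn y a).card) :
    ¬ (openGraph ω).Reachable x y := by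
  intro h
  rw [card_eq_of_reachable A h] at hx
  omega

/-- With `|A| ≤ 2j+1` two DISJOINT clusters cannot both be heavy: if `x ↮ y` and `y` is heavy then `x` is light. [folklore] -/
theorem light_of_not_reachable_of_heavy (A : Finset V) {x y : V} {j : ℕ} (hA : A.card ≤ 2 * j + 1)
    {ω : BondConfig V} (hxy : ¬ (openGraph ω).Reachable x y)
    (hy : j + 1 ≤ (A.filter fun a => ω ∈ openConn y a).card) :
    (A.filter fun a => ω ∈ openConn x a).card ≤ j := by
  by_contra hx
  push Not at hx
  have hdisj : Disjoint (A.filter fun a => ω ∈ openConn x a) (A.filter fun a => ω ∈ openConn y a) := by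
    rw [Finset.disjoint_left]
    intro a hax hay
    rw [Finset.mem_filter] at hax hay
    exact hxy (hax.2.trans hay.2.symm)
  have hsub : (A.filter fun a => ω ∈ openConn x a) ∪ (A.filter fun a => ω ∈ openConn y a) ⊆ A :=
    Finset.union_subset (Finset.filter_subset _ _) (Finset.filter_subset _ _)
  have := Finset.card_le_card hsub
  rw [Finset.card_union_of_disjoint hdisj] at this
  omega

/-- Membership in the union cluster `C_S = ⋃_{s∈S} C_s`, read as reachability. [folklore] -/
theorem unionCount_iff (S : Set V) (ω : BondConfig V) (a : V) :
    (a ∈ S ∨ ∃ e ∈ ⋃ s ∈ S, openEdgeCluster ω s, a ∈ e) ↔ ∃ s ∈ S, (openGraph ω).Reachable s a := by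
  have h := Set.ext_iff.1 (TwoSetConditionalAssociation.setOf_mem_or_exists_mem_biUnion_openEdgeCluster S a) ω
  simp only [mem_setOf_eq, mem_iUnion, exists_prop] at h ⊢
  exact h

end GiantExchange

open GiantExchange

variable {V : Type*}

/-- **Giant tripod exchange (PROVED, all `A`, `j`).**
`μ(o↔x, x light, y heavy) · μ(o↔y, y light, x heavy) ≤ μ(o↔x, x heavy, y light) · μ(o↔y, y heavy, x light)`.
Instance of `Literature.twoClusterExchange` (BHK 2006 Thm 1.5) with `s = x`, `t = y` and the cardinality-typed events
`A₁ = {o ∈ C_x}`, `B₁ = {x light} ∩ {y heavy}`, `A₂ = {x heavy} ∩ {y light}`, `B₂ = {o ∈ C_y}`; the conditioning `{x ↮ y}` is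
implied by "one light, one heavy".
[cite: VandenbergHaggstromKahn2005, Thm. 1.5 (p. 7) — corollary via `twoClusterExchange`, derived in this file] -/
theorem giant_tripodExchange [Fintype V] (w : Sym2 V → unitInterval) (A : Finset V) (o x y : V) (j : ℕ) :
    (prodBernoulli w).real (openConn o x ∩ {ω | (A.filter fun a => ω ∈ openConn x a).card ≤ j} ∩
        {ω | j + 1 ≤ (A.filter fun a => ω ∈ openConn y a).card}) *
      (prodBernoulli w).real (openConn o y ∩ {ω | (A.filter fun a => ω ∈ openConn y a).card ≤ j} ∩
        {ω | j + 1 ≤ (A.filter fun a => ω ∈ openConn x a).card}) ≤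
    (prodBernoulli w).real (openConn o x ∩ {ω | j + 1 ≤ (A.filter fun a => ω ∈ openConn x a).card} ∩
        {ω | (A.filter fun a => ω ∈ openConn y a).card ≤ j}) *
      (prodBernoulli w).real (openConn o y ∩ {ω | j + 1 ≤ (A.filter fun a => ω ∈ openConn y a).card} ∩
        {ω | (A.filter fun a => ω ∈ openConn x a).card ≤ j}) := by
  by_cases hxy : x = y
  · subst hxy
    have h0 : (openConn o x ∩ {ω : BondConfig V | (A.filter fun a => ω ∈ openConn x a).card ≤ j} ∩
        {ω | j + 1 ≤ (A.filter fun a => ω ∈ openConn x a).card}) = ∅ := by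
      ext ω; simp only [mem_inter_iff, mem_setOf_eq, mem_empty_iff_false, iff_false]
      rintro ⟨⟨_, h1⟩, h2⟩; omega
    rw [h0, measureReal_empty, zero_mul]
    exact mul_nonneg measureReal_nonneg measureReal_nonneg
  set Lx : Set (BondConfig V) := {ω | (A.filter fun a => ω ∈ openConn x a).card ≤ j} with hLx
  set Hx : Set (BondConfig V) := {ω | j + 1 ≤ (A.filter fun a => ω ∈ openConn x a).card} with hHx
  set Ly : Set (BondConfig V) := {ω | (A.filter fun a => ω ∈ openConn y a).card ≤ j} with hLy
  set Hy : Set (BondConfig V) := {ω | j + 1 ≤ (A.filter fun a => ω ∈ openConn y a).card} with hHy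
  have key := twoClusterExchange w hxy (A₁ := openConn x o) (A₂ := Hx ∩ Ly) (B₁ := Lx ∩ Hy) (B₂ := openConn y o)
    (fun ω ω' hs ht h => typePlus_openConn x y o hs ht h)
    (fun ω ω' hs ht h => ⟨le_trans h.1 (card_mono_of_cluster_subset A hs), le_trans (card_mono_of_cluster_subset A ht) h.2⟩)
    (fun ω ω' hs ht h => ⟨le_trans (card_mono_of_cluster_subset A hs) h.1, le_trans h.2 (card_mono_of_cluster_subset A ht)⟩)
    (fun ω ω' hs ht h => typeMinus_openConn x y o hs ht h)
  -- identify the four events (the separation `x ↮ y` is automatic)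
  have e1 : ((openConn x y : Set (BondConfig V))ᶜ ∩ (openConn x o ∩ (Lx ∩ Hy))) = openConn o x ∩ Lx ∩ Hy := by
    ext ω; simp only [mem_inter_iff, mem_compl_iff, openConn, mem_setOf_eq, hLx, hHy]
    constructor
    · rintro ⟨_, hxo, hl, hh⟩; exact ⟨⟨hxo.symm, hl⟩, hh⟩
    · rintro ⟨⟨hox, hl⟩, hh⟩; exact ⟨not_reachable_of_light_heavy A hl hh, hox.symm, hl, hh⟩
  have e2 : ((openConn x y : Set (BondConfig V))ᶜ ∩ (Hx ∩ Ly ∩ openConn y o)) = openConn o y ∩ Ly ∩ Hx := by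
    ext ω; simp only [mem_inter_iff, mem_compl_iff, openConn, mem_setOf_eq, hHx, hLy]
    constructor
    · rintro ⟨_, ⟨hh, hl⟩, hyo⟩; exact ⟨⟨hyo.symm, hl⟩, hh⟩
    · rintro ⟨⟨hoy, hl⟩, hh⟩
      exact ⟨fun h => not_reachable_of_light_heavy A hl hh h.symm, ⟨hh, hl⟩, hoy.symm⟩
  have e3 : ((openConn x y : Set (BondConfig V))ᶜ ∩ (openConn x o ∩ (Hx ∩ Ly))) = openConn o x ∩ Hx ∩ Ly := by
    ext ω; simp only [mem_inter_iff, mem_compl_iff, openConn, mem_setOf_eq, hHx, hLy]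
    constructor
    · rintro ⟨_, hxo, hh, hl⟩; exact ⟨⟨hxo.symm, hh⟩, hl⟩
    · rintro ⟨⟨hox, hh⟩, hl⟩
      exact ⟨fun h => not_reachable_of_light_heavy A hl hh h.symm, hox.symm, hh, hl⟩
  have e4 : ((openConn x y : Set (BondConfig V))ᶜ ∩ (Lx ∩ Hy ∩ openConn y o)) = openConn o y ∩ Hy ∩ Lx := by
    ext ω; simp only [mem_inter_iff, mem_compl_iff, openConn, mem_setOf_eq, hLx, hHy]
    constructor
    · rintro ⟨_, ⟨hl, hh⟩, hyo⟩; exact ⟨⟨hyo.symm, hh⟩, hl⟩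
    · rintro ⟨⟨hoy, hh⟩, hl⟩; exact ⟨not_reachable_of_light_heavy A hl hh, ⟨hl, hh⟩, hoy.symm⟩
  rw [e1, e2, e3, e4] at key
  exact key

/-- **Giant path exchange (PROVED, `|A| ≤ 2j+1`).**
`μ(o↔x, x light, y heavy) · μ(o↮x, o↮y, x heavy, y light) ≤ μ(o↔x, x heavy, y light) · μ(o↮x, o↮y, x light, y heavy)`.
Proof = `Theorems.pathExchange` verbatim with cardinality events: condition on `D' = {y ↮ x, y ↮ o}` and apply
`Literature.setClusterEventExchange` (BHK 2006 two-SET conditional association, `S = {x,o}`, `T = {y}`) to the increasing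
functionals `P₁ = {x ↔ o inside C_S}`, `P₂ = {|A ∩ V(C_S)| ≥ j+1}` of `C_S` and `Q₁ = {|A ∩ V(C_T)| ≥ j+1}`, `Q₂ = ⊤` of `C_T`;
with at most one heavy cluster (`|A| ≤ 2j+1`) the four events are read off as above (`μ(D'∩Q₁) = V + m°_y`,
`μ(D'∩P₂) ≥ R + m°_x`).
[cite: VandenbergHaggstromKahn2005, Thm. 2.1 (p. 9) at q = 1 with Remark 1 (p. 5) — corollary via `setClusterEventExchange`, derived in this file] -/
theorem giant_pathExchange [Fintype V] (w : Sym2 V → unitInterval) (A : Finset V) (o x y : V) (j : ℕ)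
    (hA : A.card ≤ 2 * j + 1) :
    (prodBernoulli w).real (openConn o x ∩ {ω | (A.filter fun a => ω ∈ openConn x a).card ≤ j} ∩
        {ω | j + 1 ≤ (A.filter fun a => ω ∈ openConn y a).card}) *
      (prodBernoulli w).real ({ω | j + 1 ≤ (A.filter fun a => ω ∈ openConn x a).card} ∩
        {ω | (A.filter fun a => ω ∈ openConn y a).card ≤ j} ∩ (openConn o x)ᶜ ∩ (openConn o y)ᶜ) ≤
    (prodBernoulli w).real (openConn o x ∩ {ω | j + 1 ≤ (A.filter fun a => ω ∈ openConn x a).card} ∩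
        {ω | (A.filter fun a => ω ∈ openConn y a).card ≤ j}) *
      (prodBernoulli w).real ({ω | (A.filter fun a => ω ∈ openConn x a).card ≤ j} ∩
        {ω | j + 1 ≤ (A.filter fun a => ω ∈ openConn y a).card} ∩ (openConn o x)ᶜ ∩ (openConn o y)ᶜ) := by
  set μ := prodBernoulli w with hμ
  set Lx : Set (BondConfig V) := {ω | (A.filter fun a => ω ∈ openConn x a).card ≤ j} with hLx
  set Hx : Set (BondConfig V) := {ω | j + 1 ≤ (A.filter fun a => ω ∈ openConn x a).card} with hHx
  set Ly : Set (BondConfig V) := {ω | (A.filter fun a => ω ∈ openConn y a).card ≤ j} with hLy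
  set Hy : Set (BondConfig V) := {ω | j + 1 ≤ (A.filter fun a => ω ∈ openConn y a).card} with hHy
  set S : Set V := {x, o} with hS
  set T : Set V := {y} with hT
  have hxS : x ∈ S := by rw [hS]; exact mem_insert x {o}
  -- the set exchange with cardinality functionals
  have key := setClusterEventExchange w S T
    (fun C => (SimpleGraph.fromEdgeSet C).Reachable x o)
    (fun C => j + 1 ≤ (A.filter fun a => a ∈ S ∨ ∃ e ∈ C, a ∈ e).card)
    (fun C => j + 1 ≤ (A.filter fun a => a ∈ T ∨ ∃ e ∈ C, a ∈ e).card) (fun _ => True)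
    (fun C C' h hr => PathExchange.reachIn_mono x o h hr)
    (fun C C' h hc => le_trans hc (Finset.card_le_card fun a ha => by
      rw [Finset.mem_filter] at ha ⊢
      exact ⟨ha.1, ha.2.imp_right fun ⟨e, he, hae⟩ => ⟨e, h he, hae⟩⟩))
    (fun C C' h hc => le_trans hc (Finset.card_le_card fun a ha => by
      rw [Finset.mem_filter] at ha ⊢
      exact ⟨ha.1, ha.2.imp_right fun ⟨e, he, hae⟩ => ⟨e, h he, hae⟩⟩))
    (fun _ _ _ _ => trivial)
  set D' : Set (BondConfig V) := {ω : BondConfig V | ∀ s ∈ S, ∀ t ∈ T, ¬ (openGraph ω).Reachable s t} with hD'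
  have hD : ∀ ω : BondConfig V, ω ∈ D' ↔ (¬ (openGraph ω).Reachable x y ∧ ¬ (openGraph ω).Reachable o y) := by
    intro ω
    simp only [hD', hS, hT, mem_setOf_eq, mem_insert_iff, mem_singleton_iff, forall_eq_or_imp, forall_eq]
  -- pointwise identification of the functionals
  have hP1 : ∀ ω : BondConfig V, (SimpleGraph.fromEdgeSet (⋃ s ∈ S, openEdgeCluster ω s)).Reachable x o ↔
      (openGraph ω).Reachable x o := fun ω => PathExchange.reachIn_biUnion_iff ω S x o hxS
  have hmemS : ∀ (ω : BondConfig V) (a : V), (a ∈ S ∨ ∃ e ∈ ⋃ s ∈ S, openEdgeCluster ω s, a ∈ e) ↔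
      ((openGraph ω).Reachable x a ∨ (openGraph ω).Reachable o a) := by
    intro ω a
    rw [unionCount_iff S ω a, hS]
    constructor
    · rintro ⟨s, hs, hsa⟩
      rcases hs with rfl | rfl
      · exact Or.inl hsa
      · exact Or.inr hsa
    · rintro (h | h)
      · exact ⟨x, mem_insert x {o}, h⟩
      · exact ⟨o, mem_insert_of_mem x rfl, h⟩
  have hmemT : ∀ (ω : BondConfig V) (a : V), (a ∈ T ∨ ∃ e ∈ ⋃ t ∈ T, openEdgeCluster ω t, a ∈ e) ↔
      (openGraph ω).Reachable y a := by
    intro ω a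
    rw [unionCount_iff T ω a, hT]
    constructor
    · rintro ⟨s, hs, hsa⟩
      rw [mem_singleton_iff] at hs
      subst hs; exact hsa
    · intro h; exact ⟨y, rfl, h⟩
  -- the union count on `{o ↔ x}` is `|π(x)|`, and in general dominates `|π(x)|`
  have hU_eq : ∀ ω : BondConfig V, (openGraph ω).Reachable o x →
      (A.filter fun a => a ∈ S ∨ ∃ e ∈ ⋃ s ∈ S, openEdgeCluster ω s, a ∈ e).card =
        (A.filter fun a => ω ∈ openConn x a).card := by
    intro ω hox
    rw [Finset.filter_congr (fun a _ => hmemS ω a)]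
    congr 1
    apply Finset.filter_congr
    intro a _
    exact ⟨fun h => h.elim id fun hoa => hox.symm.trans hoa, fun h => Or.inl h⟩
  have hU_ge : ∀ ω : BondConfig V, (A.filter fun a => ω ∈ openConn x a).card ≤
      (A.filter fun a => a ∈ S ∨ ∃ e ∈ ⋃ s ∈ S, openEdgeCluster ω s, a ∈ e).card := by
    intro ω
    apply Finset.card_le_card
    intro a ha
    rw [Finset.mem_filter] at ha ⊢
    exact ⟨ha.1, (hmemS ω a).2 (Or.inl ha.2)⟩
  have hT_eq : ∀ ω : BondConfig V, (A.filter fun a => a ∈ T ∨ ∃ e ∈ ⋃ t ∈ T, openEdgeCluster ω t, a ∈ e).card =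
      (A.filter fun a => ω ∈ openConn y a).card := by
    intro ω
    rw [Finset.filter_congr (fun a _ => hmemT ω a)]
    rfl
  -- the cells
  set Vv := μ.real (openConn o x ∩ Lx ∩ Hy) with hVv
  set Rr := μ.real (openConn o x ∩ Hx ∩ Ly) with hRr
  set Mx := μ.real (Hx ∩ Ly ∩ (openConn o x)ᶜ ∩ (openConn o y)ᶜ) with hMx
  set My := μ.real (Lx ∩ Hy ∩ (openConn o x)ᶜ ∩ (openConn o y)ᶜ) with hMy
  -- (i) D' ∩ P₁ ∩ Q₁ = V-event
  have e1 : D' ∩ ({ω | (SimpleGraph.fromEdgeSet (⋃ s ∈ S, openEdgeCluster ω s)).Reachable x o} ∩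
      {ω | j + 1 ≤ (A.filter fun a => a ∈ T ∨ ∃ e ∈ ⋃ t ∈ T, openEdgeCluster ω t, a ∈ e).card}) =
      openConn o x ∩ Lx ∩ Hy := by
    ext ω
    simp only [mem_inter_iff, mem_setOf_eq, hD ω, hP1 ω, hT_eq ω, hLx, hHy, openConn]
    constructor
    · rintro ⟨⟨hxy, _⟩, hxo, hh⟩
      exact ⟨⟨hxo.symm, light_of_not_reachable_of_heavy A hA hxy hh⟩, hh⟩
    · rintro ⟨⟨hox, hl⟩, hh⟩
      have hxy := not_reachable_of_light_heavy A hl hh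
      exact ⟨⟨hxy, fun hoy => hxy (hox.symm.trans hoy)⟩, hox.symm, hh⟩
  -- (ii) D' ∩ P₁ ∩ P₂ = R-event
  have e2 : D' ∩ ({ω | (SimpleGraph.fromEdgeSet (⋃ s ∈ S, openEdgeCluster ω s)).Reachable x o} ∩
      {ω | j + 1 ≤ (A.filter fun a => a ∈ S ∨ ∃ e ∈ ⋃ s ∈ S, openEdgeCluster ω s, a ∈ e).card}) =
      openConn o x ∩ Hx ∩ Ly := by
    ext ω
    simp only [mem_inter_iff, mem_setOf_eq, hD ω, hP1 ω, hHx, hLy, openConn]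
    constructor
    · rintro ⟨⟨hxy, _⟩, hxo, hh⟩
      rw [hU_eq ω hxo.symm] at hh
      exact ⟨⟨hxo.symm, hh⟩, light_of_not_reachable_of_heavy A hA (fun h => hxy h.symm) hh⟩
    · rintro ⟨⟨hox, hh⟩, hl⟩
      have hxy : ¬ (openGraph ω).Reachable x y := fun h => not_reachable_of_light_heavy A hl hh h.symm
      refine ⟨⟨hxy, fun hoy => hxy (hox.symm.trans hoy)⟩, hox.symm, ?_⟩
      rw [hU_eq ω hox]; exact hh
  -- (iii) μ(D' ∩ Q₁) = V + m°_y
  have e3 : μ.real (D' ∩ ({ω | j + 1 ≤ (A.filter fun a => a ∈ T ∨ ∃ e ∈ ⋃ t ∈ T, openEdgeCluster ω t, a ∈ e).card} ∩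
      {ω | True})) = Vv + My := by
    have hsplit : D' ∩ ({ω | j + 1 ≤ (A.filter fun a => a ∈ T ∨ ∃ e ∈ ⋃ t ∈ T, openEdgeCluster ω t, a ∈ e).card} ∩
        {ω | True}) = (openConn o x ∩ Lx ∩ Hy) ∪ (Lx ∩ Hy ∩ (openConn o x)ᶜ ∩ (openConn o y)ᶜ) := by
      ext ω
      simp only [mem_inter_iff, mem_compl_iff, mem_setOf_eq, hD ω, hT_eq ω, hLx, hHy, openConn, mem_union, and_true]
      constructor
      · rintro ⟨⟨hxy, hoy⟩, hh⟩
        have hl := light_of_not_reachable_of_heavy A hA hxy hh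
        by_cases hox : (openGraph ω).Reachable o x
        · exact Or.inl ⟨⟨hox, hl⟩, hh⟩
        · exact Or.inr ⟨⟨⟨hl, hh⟩, hox⟩, hoy⟩
      · rintro (⟨⟨hox, hl⟩, hh⟩ | ⟨⟨⟨hl, hh⟩, hox⟩, hoy⟩)
        · have hxy := not_reachable_of_light_heavy A hl hh
          exact ⟨⟨hxy, fun hoy => hxy (hox.symm.trans hoy)⟩, hh⟩
        · exact ⟨⟨not_reachable_of_light_heavy A hl hh, hoy⟩, hh⟩
    rw [hsplit, measureReal_union ?_ MeasurableSet.of_discrete]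
    exact Set.disjoint_left.2 fun ω h1 h2 => h2.1.2 h1.1.1
  -- (iv) μ(D' ∩ P₂) ≥ R + m°_x
  have e4 : Rr + Mx ≤ μ.real (D' ∩ ({ω | j + 1 ≤ (A.filter fun a => a ∈ S ∨ ∃ e ∈ ⋃ s ∈ S, openEdgeCluster ω s, a ∈ e).card} ∩
      {ω | True})) := by
    have hsub : (openConn o x ∩ Hx ∩ Ly) ∪ (Hx ∩ Ly ∩ (openConn o x)ᶜ ∩ (openConn o y)ᶜ) ⊆
        D' ∩ ({ω | j + 1 ≤ (A.filter fun a => a ∈ S ∨ ∃ e ∈ ⋃ s ∈ S, openEdgeCluster ω s, a ∈ e).card} ∩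
          {ω | True}) := by
      intro ω hω
      simp only [mem_inter_iff, mem_compl_iff, mem_setOf_eq, hD ω, hHx, hLy, openConn, mem_union, and_true] at hω ⊢
      rcases hω with ⟨⟨hox, hh⟩, hl⟩ | ⟨⟨⟨hh, hl⟩, hox⟩, hoy⟩
      · have hxy : ¬ (openGraph ω).Reachable x y := fun h => not_reachable_of_light_heavy A hl hh h.symm
        exact ⟨⟨hxy, fun hoy => hxy (hox.symm.trans hoy)⟩, le_trans hh (hU_ge ω)⟩
      · exact ⟨⟨fun h => not_reachable_of_light_heavy A hl hh h.symm, hoy⟩, le_trans hh (hU_ge ω)⟩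
    have hdisj : Disjoint (openConn o x ∩ Hx ∩ Ly) (Hx ∩ Ly ∩ (openConn o x)ᶜ ∩ (openConn o y)ᶜ) :=
      Set.disjoint_left.2 fun ω h1 h2 => h2.1.2 h1.1.1
    calc Rr + Mx = μ.real ((openConn o x ∩ Hx ∩ Ly) ∪ (Hx ∩ Ly ∩ (openConn o x)ᶜ ∩ (openConn o y)ᶜ)) := by
          rw [measureReal_union hdisj MeasurableSet.of_discrete]
      _ ≤ _ := measureReal_mono hsub
  rw [e1, e2, e3] at key
  have hV0 : 0 ≤ Vv := measureReal_nonneg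
  have h1 : Vv * (Rr + Mx) ≤ Vv * μ.real (D' ∩ ({ω | j + 1 ≤ (A.filter fun a => a ∈ S ∨ ∃ e ∈ ⋃ s ∈ S, openEdgeCluster ω s, a ∈ e).card} ∩
      {ω | True})) := mul_le_mul_of_nonneg_left e4 hV0
  nlinarith [h1, key]

end Summit.CriticalPhenomena.PercolationContinuityZ3.Theorems

end
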